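import Literature.AnabelianGeometry.AbsoluteAnabelian.RelativeGCHomSchemaWitnesses
import Literature.AnabelianGeometry.AbsoluteAnabelian.SubpadicIsGeneralizedSubpadic
import HarnessLib

/-!
# Schema witnesses for `RelativeGrothendieckConjecture.lean`, II: `HomOver.InnerEquiv`,
# `RelativeAnabelianDatum.RelIsomGC`, `Tpcs.Thm_4_12` (FACT-LIST rows F-1789, F-0259, F-0261)

Proof-only companion (no `def`, no `instance`; witness data are built inside the theorem terms) to
`RelativeGrothendieckConjecture.lean` ([pGC] S. Mochizuki, *The local pro-p anabelian geometry of curves*,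
Invent. Math. 138 (1999), Thm A p. 3; [Tpcs] S. Mochizuki, *Topics surrounding the anabelian geometry of
hyperbolic curves* (2003), Def 4.11 / Thm 4.12 p. 44 — manuscript paginations, lit keys
`paper:url-138ee71e276d`, `paper:url-b6dd3c96bfbd`), continuing `RelativeGCHomSchemaWitnesses.lean`
(abc-iut-f-106: the junk datum `RelativeAnabelianDatum.exists_homEmpty_witness`, rows F-1792/F-1794/F-1795).
The three declarations below are PARAMETRISED (schemata over binders), typed MODEL-RELATIVELY over an
abstract `AugmentedProfiniteGrp` / `RelativeAnabelianDatum` (cell ruling θ, shape (M): the étale `π₁` of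
hyperbolic curves is not in the tree; "a junk datum falsifies only its own instance").  abc-iut block F,
plan header rule R1 (ii): for a parametrised row whose universal closure is false, file `not_forall_<decl>`
and record the instance forms.  Sorry-free, by kernel-checked theorems with honest labels:

* `HomOver.InnerEquiv` (F-1789) is a RELATION ("`Δ`-conjugacy" of homomorphisms over `G`: [pGC] Thm A
  p. 3 "considered up to composition with an inner automorphism arising from `Δ_Y`") — vocabulary, not a
  claim.  Its laws ARE facts and are proved (`InnerEquiv.refl/symm/trans`, `innerEquiv_conj`,
  `InnerEquiv.map_eq_one_iff`); its universal closure is FALSE (`HomOver.not_forall_innerEquiv`): over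
  every base group `G` and every profinite `D` with an element `d ≠ 1`, on the split product `D × G ↠ G`
  the identity is not `Δ`-conjugate to `(x, g) ↦ (1, g)` (`exists_not_innerEquiv_prod`; closed instance
  `D = ℤˣ = {±1}`, `exists_not_innerEquiv`).
* `RelativeAnabelianDatum.RelIsomGC` (F-0259) is the CONCLUSION PREDICATE of [Tpcs] Thm 4.12 / of the
  isomorphism form of [pGC] Thm A, not an independent fact: universal closure FALSE
  (`RelativeAnabelianDatum.not_forall_relIsomGC`, from abc-iut-f-106's junk datum — one object declared a
  hyperbolic curve, `Π = G ↠ G`, NO scheme morphisms, so the class of the identity, an outer isomorphism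
  over `G`, is not hit); it holds at the point datum (`RelativeAnabelianDatum.exists_point`); the instance
  form the Belyi-cuspidalization chain consumes is SUPPLIED BY [Tpcs] Thm 4.12
  (`relIsomGC_of_thm_4_12_of_isSubpadicFor`, `RelativeGCReductions.lean`).
* `Tpcs.Thm_4_12 p K D` (F-0261): once `K` is generalized sub-`p`-adic and `p ∈ Σ`, the typed schema
  constrains ONLY the datum `D`.  Over every such `K` there is a datum at which it FAILS
  (`Tpcs.exists_not_thm_4_12`) — in particular over `ℚ`, which is sub-`p`-adic for every `p` ([pGC] Def 15.4
  (i) example (2) p. 77, `IsSubpadicFor.of_numberField`) hence generalized sub-`p`-adic ([Tpcs] Remark after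
  Def 4.11 p. 44, `IsSubpadicFor.isGeneralizedSubpadicFor`; `Tpcs.isGeneralizedSubpadicFor_rat`) — and over
  every `K` a datum at which it HOLDS for all `p` (`pGC.exists_datum_thmA_and_thmA_isom`, abc-iut-f-106).
  Hence the universal closure is FALSE (`Tpcs.not_forall_thm_4_12`; per field `Tpcs.not_forall_datum_thm_4_12`)
  and the row is consumable AT NAMED INSTANCES ONLY.  The INTENDED instance (`D` = étale fundamental groups
  of hyperbolic curves over `K`) is Mochizuki's theorem [Tpcs] Thm 4.12 (via [pGC] Thm A and Faltings'
  `p`-adic Hodge theory), whose objects the tree does not have (abc-iut FOUNDATIONS rows 12/16/25): there it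
  stays a NAMED FACT.

HONEST FRAMING: statements about OUR typed interface; nothing here asserts or denies [pGC] Thm A /
[Tpcs] Thm 4.12 for curves; no bearing on the disputed [IUTchIII] Cor 3.12; typed ≠ proved; a FACT row
is an assumption label, not an endorsement.
-/

universe u

namespace Literature.AnabelianGeometry.AbsoluteAnabelian

open AugmentedProfiniteGrp

/-! ### F-1789 `HomOver.InnerEquiv`: the relation's laws (the instance forms that hold) -/

namespace AugmentedProfiniteGrp.HomOver

variable {G : ProfiniteGrp.{u}} {A B : AugmentedProfiniteGrp G}

/-- `Δ`-conjugacy is reflexive ([pGC] Thm A p. 3: take the inner automorphism to be trivial).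
[cite: MochizukiLocAn1999, Thm A p.3] -/
theorem InnerEquiv.refl (φ : HomOver A B) : InnerEquiv φ φ :=
  InnerEquiv.equivalence.refl φ

/-- `Δ`-conjugacy is symmetric. [cite: MochizukiLocAn1999, Thm A p.3] -/
theorem InnerEquiv.symm {φ ψ : HomOver A B} (h : InnerEquiv φ ψ) : InnerEquiv ψ φ :=
  InnerEquiv.equivalence.symm h

/-- `Δ`-conjugacy is transitive. [cite: MochizukiLocAn1999, Thm A p.3] -/
theorem InnerEquiv.trans {φ ψ χ : HomOver A B} (h₁ : InnerEquiv φ ψ) (h₂ : InnerEquiv ψ χ) :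
    InnerEquiv φ χ :=
  InnerEquiv.equivalence.trans h₁ h₂

/-- A homomorphism over `G` is `Δ`-conjugate to each of its `Δ_B`-conjugates (the defining instance).
[cite: MochizukiLocAn1999, Thm A p.3] -/
theorem innerEquiv_conj (φ : HomOver A B) (g : B.arith) (hg : g ∈ B.geom) :
    InnerEquiv φ (HomOver.conj g hg φ) :=
  ⟨g, hg, rfl⟩

/-- `Δ`-conjugate homomorphisms have the same kernel: `ψ x = 1 ↔ φ x = 1` (a conjugate of `y` is `1`
iff `y = 1`). [cite: MochizukiLocAn1999, Thm A p.3] -/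
theorem InnerEquiv.map_eq_one_iff {φ ψ : HomOver A B} (h : InnerEquiv φ ψ) (x : A.arith) :
    ψ.toHom x = 1 ↔ φ.toHom x = 1 := by
  obtain ⟨g, hg, rfl⟩ := h
  rw [conj_apply]
  constructor
  · intro h1
    have h2 : g * φ.toHom x = g := by
      calc g * φ.toHom x = g * φ.toHom x * g⁻¹ * g := by group
        _ = g := by rw [h1, one_mul]
    exact mul_eq_left.mp h2
  · intro h1
    rw [h1, mul_one, mul_inv_cancel]

/-! ### F-1789: the universal closure of the relation is false -/

/-- **Split-product witness.**  Over ANY base group `G`, for ANY profinite `D` with an element `d ≠ 1`: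
on the split extension `Π := D × G ↠ G` the identity and the homomorphism `(x, g) ↦ (1, g)` are both
over `G` but NOT `Δ`-conjugate (different kernels).  So "considered up to composition with an inner
automorphism arising from `Δ`" ([pGC] Thm A p. 3) is a genuine equivalence RELATION, not a property of
every pair. [cite: MochizukiLocAn1999, Thm A p.3] -/
theorem exists_not_innerEquiv_prod (G D : ProfiniteGrp.{u}) (d : D) (hd : d ≠ 1) :
    ∃ (P : AugmentedProfiniteGrp G) (φ ψ : HomOver P P), ¬ InnerEquiv φ ψ := by
  let P : AugmentedProfiniteGrp G :=
    { arith := ProfiniteGrp.of (D × G)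
      aug := ContinuousMonoidHom.snd D G
      aug_surjective := fun g => ⟨(1, g), rfl⟩ }
  let φ : HomOver P P := ⟨ContinuousMonoidHom.id _, fun _ => rfl⟩
  let ψ : HomOver P P :=
    ⟨(ContinuousMonoidHom.inr D G).comp (ContinuousMonoidHom.snd D G), fun _ => rfl⟩
  refine ⟨P, φ, ψ, fun h => hd ?_⟩
  have h1 : φ.toHom ((d, 1) : D × G) = 1 := (h.map_eq_one_iff ((d, 1) : D × G)).mp rfl
  exact (Prod.mk_eq_one.mp h1).1

/-- Closed instance (universe `0`): base group the trivial group, `D = ℤˣ = {±1}` (discrete), `d = -1`.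
[cite: MochizukiLocAn1999, Thm A p.3] -/
theorem exists_not_innerEquiv :
    ∃ (G : ProfiniteGrp.{0}) (P : AugmentedProfiniteGrp G) (φ ψ : HomOver P P), ¬ InnerEquiv φ ψ :=
  ⟨ProfiniteGrp.ofFiniteGrp (FiniteGrp.of PUnit.{1}),
    exists_not_innerEquiv_prod _ (ProfiniteGrp.ofFiniteGrp (FiniteGrp.of ℤˣ)) (-1 : ℤˣ)
      fun h => absurd h (show (-1 : ℤˣ) ≠ 1 by decide)⟩

/-- **F-1789, universal closure REFUTED**: it is false that all homomorphisms over `G` are pairwise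
`Δ`-conjugate (schema row; the relation is vocabulary — its laws `InnerEquiv.refl/symm/trans` are the
facts). [cite: MochizukiLocAn1999, Thm A p.3] -/
theorem not_forall_innerEquiv :
    ¬ ∀ (G : ProfiniteGrp.{0}) (A B : AugmentedProfiniteGrp G) (φ ψ : HomOver A B),
        Literature.AnabelianGeometry.AbsoluteAnabelian.AugmentedProfiniteGrp.HomOver.InnerEquiv φ ψ := by
  intro h
  obtain ⟨G, P, φ, ψ, hne⟩ := exists_not_innerEquiv
  exact hne (h G P P φ ψ)

end AugmentedProfiniteGrp.HomOver

/-! ### F-0259 `RelativeAnabelianDatum.RelIsomGC`: conclusion predicate, violated by the junk datum -/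

/-- **F-0259, universal closure REFUTED**: not every relative anabelian datum satisfies the relative
isom-GC conclusion — abc-iut-f-106's junk datum (`exists_homEmpty_witness`: one object declared a
hyperbolic curve, `Π = G ↠ G`, no scheme morphisms; the identity outer isomorphism has no preimage)
over the trivial group violates it.  Schema row: `RelIsomGC` is what [Tpcs] Thm 4.12 / [pGC] Thm A (isom
form) ASSERT of the étale-`π₁` datum; consumers obtain it FROM those named facts
(`relIsomGC_of_thm_4_12_of_isSubpadicFor`), and it holds at the point datum (`exists_point`).
[cite: MochizukiTopics2003, Thm 4.12 p.44] -/
theorem RelativeAnabelianDatum.not_forall_relIsomGC :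
    ¬ ∀ (G : ProfiniteGrp.{u}) (D : RelativeAnabelianDatum G),
        Literature.AnabelianGeometry.AbsoluteAnabelian.RelativeAnabelianDatum.RelIsomGC D := by
  intro h
  obtain ⟨D, -, hD⟩ :=
    RelativeAnabelianDatum.exists_not_relIsomGC (ProfiniteGrp.ofFiniteGrp (FiniteGrp.of PUnit.{u + 1}))
  exact hD (h _ D)

/-! ### F-0261 `Tpcs.Thm_4_12`: over a generalized sub-`p`-adic field the schema constrains only the datum -/

/-- Over EVERY generalized sub-`p`-adic field `K` (the printed hypothesis of [Tpcs] Thm 4.12 p. 44)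
there is a datum with `p ∈ Σ` (`Σ` = all primes), all objects declared hyperbolic curves, at which the
typed schema `Tpcs.Thm_4_12 p K D` FAILS: the junk datum `exists_homEmpty_witness` over `Γ_K`.  Shape
(M): this falsifies the junk instance, not the theorem about curves. [cite: MochizukiTopics2003, Thm 4.12 p.44] -/
theorem Tpcs.exists_not_thm_4_12 (p : ℕ) [Fact p.Prime] (K : Type u) [Field K] [CharZero K]
    (hK : AbsTopIII.IsGeneralizedSubpadicFor K p) :
    ∃ D : RelativeAnabelianDatum (absoluteGaloisGrp K),
      p ∈ D.primes ∧ (∀ X, D.IsHyperbolicCurve X) ∧ ¬ Tpcs.Thm_4_12 p K D := by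
  obtain ⟨D, hprimes, hhyp, -, hnot⟩ :=
    RelativeAnabelianDatum.exists_homEmpty_witness (absoluteGaloisGrp K)
  have hp : p ∈ D.primes := by
    rw [hprimes]
    exact Set.mem_univ p
  exact ⟨D, hp, hhyp, fun h => hnot (h hK hp)⟩

/-- `ℚ` is generalized sub-`p`-adic for every prime `p` ([pGC] Def 15.4 (i) example (2) p. 77: number
fields are sub-`p`-adic; [Tpcs] Remark after Def 4.11 p. 44: sub-`p`-adic ⇒ generalized sub-`p`-adic —
both PROVED in the tree), so the hypothesis of `Tpcs.Thm_4_12 p ℚ D` is met and the schema is not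
vacuous over `ℚ`. [cite: MochizukiTopics2003, Def 4.11 p.44] -/
theorem Tpcs.isGeneralizedSubpadicFor_rat (p : ℕ) [Fact p.Prime] :
    AbsTopIII.IsGeneralizedSubpadicFor ℚ p :=
  (AbsTopIII.IsSubpadicFor.of_numberField ℚ p).isGeneralizedSubpadicFor

/-- **F-0261, universal closure REFUTED**: `Tpcs.Thm_4_12 p K D` does not hold for all `p, K, D` —
already over `K = ℚ` (generalized sub-`2`-adic) the junk datum of `Tpcs.exists_not_thm_4_12` violates
it.  Consequence of record: the row is consumable AT NAMED INSTANCES ONLY; its intended instance (étale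
`π₁` of hyperbolic curves) is Mochizuki's theorem and is not constructed in the tree; a model instance
where it holds is `pGC.exists_datum_thmA_and_thmA_isom`. [cite: MochizukiTopics2003, Thm 4.12 p.44] -/
theorem Tpcs.not_forall_thm_4_12 :
    ¬ ∀ (p : ℕ) [Fact p.Prime] (K : Type) [Field K] [CharZero K]
        (D : RelativeAnabelianDatum (absoluteGaloisGrp K)),
        Literature.AnabelianGeometry.AbsoluteAnabelian.Tpcs.Thm_4_12 p K D := by
  intro h
  haveI : Fact (Nat.Prime 2) := ⟨Nat.prime_two⟩
  obtain ⟨D, -, -, hD⟩ := Tpcs.exists_not_thm_4_12 2 ℚ (Tpcs.isGeneralizedSubpadicFor_rat 2)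
  exact hD (h 2 ℚ D)

/-- The same at each fixed prime `p` over each generalized sub-`p`-adic `K` (any universe): the
`D`-universal closure `∀ D, Tpcs.Thm_4_12 p K D` is false. [cite: MochizukiTopics2003, Thm 4.12 p.44] -/
theorem Tpcs.not_forall_datum_thm_4_12 (p : ℕ) [Fact p.Prime] (K : Type u) [Field K] [CharZero K]
    (hK : AbsTopIII.IsGeneralizedSubpadicFor K p) :
    ¬ ∀ D : RelativeAnabelianDatum (absoluteGaloisGrp K),
        Literature.AnabelianGeometry.AbsoluteAnabelian.Tpcs.Thm_4_12 p K D := by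
  intro h
  obtain ⟨D, -, -, hD⟩ := Tpcs.exists_not_thm_4_12 p K hK
  exact hD (h D)

end Literature.AnabelianGeometry.AbsoluteAnabelian
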